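/-
Copyright (c) 2026 the pub-hodgecm-mathlib formalisation cell (harness21).  Prover seat hodgecm-mathlib-K2Liu-p02 (g0),
Track B «K2-LIT» ∕ hLiu418 #184♮, unit U3c «LOCAL SIEGEL» of the K2_Liu road, socket #7b: payment of
`K2LiuCurveThetaSigsU3cLocalSiegel.sig_K2LiuSiegelWeilSectionMem` — THE SIEGEL–WEIL SECTION `h ↦ ω_v(h)Φ(0)` LIES IN THE
DEGENERATE PRINCIPAL SERIES `I_v((1 − n)∕2, χ_v)`.  2026-09-03.
-/
import Literature.NumberTheory.K2Lit.DoubledUnitaryDegeneratePrincipalSeries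
import Literature.NumberTheory.GelbartRogawski1991.LocalSplittingCMParabolicEigenfunctional
import Summits.HodgeConjecture.HodgeConjecture.Theorems.K2LiuSiegelWeilScalarEqCharacter
import HarnessLib

/-!
# K2_Liu road (hLiu418 = stmt-HodgeConjecture-24832), unit U3c «LOCAL SIEGEL», socket #7b:
# the Siegel–Weil section `F_Φ(h) = (ω(m₀ s(w₀)) ω(s(w₀ h w₀)) Φ)(0)` of the doubled CM Weil datum lies in `I_v((1 − n)∕2, χ_v)`

Cell `pub/hodgecm-mathlib` (D-0151), Track B (21-frontier RULING «PUSH BOTH» 2026-09-03; LEAD F0P6-plan PRE-DEAL BY NAME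
2026-09-03T20:56:07Z: #7b ↦ base K2Liu-p02), socket module
`Summits/HodgeConjecture/HodgeConjecture/Cruxes/HLiu418/Lines/K2_Liu_CurveThetaSigs_U3c_LocalSiegel.lean` ED. 2 (planner
K2Liu-plan (g0), sha16 1c0910da85bf4577), socket **`sig_K2LiuSiegelWeilSectionMem`** (#7b, S–M).  SETTING = the tree's doubled
CM Weil datum at a finite place `v` of `L⁺` (★ telescope `D := localSplittingDatumCM L v μ n hT₀ hT₀d rfl χ hχ` of
`LocalDoubledUnitarySplittingDataCM`, `s := D.localSplitting : H(L⁺_v) →* S̃p_ψ(𝕎^𝔻_v)`, `ω := MpPsi.toRep (localSchrodinger …)` on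
`𝒮(L⁺_v^{n+n})`), an implementer `m₀` carrying the diagonal Lagrangian `ℓ_Δ` onto `ℓ_Y` (`hm₀`), and an involution `w₀` of
`H(L⁺_v)` (`w₀ w₀ = 1`).  CLAIM: for every Schwartz–Bruhat `Φ`, the function
`F_Φ(h) := (ω(m₀ · s(w₀)) (ω(s(w₀ h w₀)) Φ))(0)` belongs to the degenerate principal series
★ `localDegPS … χ_v ((1 − n)∕2)` of leaf D1 (★ `K2Lit/DoubledUnitaryDegeneratePrincipalSeries`): it is a SIEGEL SECTION
(`F_Φ(p h) = χ_v(det_Δ p)|det_Δ p|_v^{1∕2} F_Φ(h)` for `p ∈ P_Δ(L⁺_v)`) and it is SMOOTH (right-invariant under an open subgroup).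
[HarrisKudlaSweet1996 §1 (1.15)–(1.16): `Φ ↦ (h ↦ ω(h)Φ(0))` maps `S(𝕏)` to `I_n(s₀, χ)`; Liu 2021 §B.3 p. 101; Kudla 1994 §3 Thm. 3.1.]

THE MATHEMATICS.
* SECTION LAW.  In `S̃p_ψ(𝕎^𝔻_v)`, `m₀ s(w₀) s(w₀ (p h) w₀) = m₀ s(p h w₀) = (m₀ s(p) m₀⁻¹)(m₀ s(w₀) s(w₀ h w₀))` (`w₀ w₀ = 1`,
  `s` a homomorphism), so `F_Φ(p h) = (ω(m₀ s(p) m₀⁻¹) Θ)(0)` with `Θ = ω(m₀ s(w₀)) ω(s(w₀ h w₀)) Φ`, `Θ(0) = F_Φ(h)`; the CM datum's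
  PARABOLIC NORMALISATION ★ `parabolic_toRep_conj_localSplittingDatumCM` (`m₀` carries `ℓ_Δ` onto `ℓ_Y`, `p ∈ P_Δ`) gives
  `F_Φ(p h) = e(p) · F_Φ(h)` with the Kudla–Weil eigen-scalar `e(p) = (χ_v⁻¹(det_Δ p))⁻¹ · ∏_{w ∣ v} ‖det_Δ p_w‖^{1∕2}` (the same
  scalar as the `w₀`-twisted EIGEN-LAW ★ `apply_zero_toRep_mul_localSplitting_eq_mul`), and the NORMALISATION BRIDGE ★ #7a
  `K2LiuSiegelWeilScalarEqCharacter.siegelWeilScalarEqCharacter` (K2Liu-p03) identifies `e(p)` with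
  `localSiegelCharacter χ_v ((1 − n)∕2) p`.
* SMOOTHNESS.  The datum is smooth (★ `LocalSplittingDatum.smooth`: `Φ` is fixed by `ω ∘ s` on an open subgroup `U₀` of `H(L⁺_v)`,
  read through ★ `LocalSplittingDatum.localOmega_apply`); put `U := w₀ U₀ w₀` = the preimage of `U₀` under the continuous
  conjugation `u ↦ w₀ u w₀⁻¹ = w₀ u w₀` (Mathlib `OpenSubgroup.comap`, `MulAut.conj`, `IsTopologicalGroup.continuous_conj`); for `u ∈ U`,
  `ω(s(w₀ h u w₀)) Φ = ω(s(w₀ h w₀)) (ω(s(w₀ u w₀)) Φ) = ω(s(w₀ h w₀)) Φ`, so `F_Φ(h u) = F_Φ(h)` (the pattern of ★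
  `isLocallyConstant_toRep_localSplitting_comp`).

* §0 (abstract carriers `s : G →* M̃`, `ω : Representation ℂ M̃ V`, involution `w₀` — ALL operator algebra is done here, so that
  nothing is ever rewritten inside the CM datum's telescope): `conj_mul_conj`, `rep_conj_mul_of_fixed`, `rep_conj_parabolic`.
* §1 `toRep_localSplitting_fixed` (the open stabiliser of `Φ`), `siegelWeilFn_isSmooth` (smoothness = ★ D1 `IsSmooth`),
  `siegelWeilFn_parabolic_mul` (section law with the Kudla–Weil eigen-scalar) — §0 instantiated by `congrArg`, plus ★
  `parabolic_toRep_conj_localSplittingDatumCM`; `maxHeartbeats 4000000` on these four declarations only to ELABORATE the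
  telescope's statements (as in ★ `LocalSplittingCMParabolicEigenfunctional`), the proofs are one-liners.
* §2 **`siegelWeilSectionMem`** — `sig_K2LiuSiegelWeilSectionMem` TOKEN FOR TOKEN.

HONEST LABEL: HC_CM is proved only modulo the 7 printed citations (2 remaining named inputs: hLiu418 = stmt-HodgeConjecture-24832,
h413 = stmt-HodgeConjecture-24833) until rung 0 closes; this file is a `--supports stmt-HodgeConjecture-24832` helper (floored
scaffold of the K2_Liu road) and retires nothing by itself.
-/

set_option autoImplicit false

noncomputable section

open scoped Matrix
open NumberField IsDedekindDomain MeasureTheory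
open Literature.NumberTheory.Automorphic Literature.NumberTheory.Automorphic.UnitaryGroup Literature.NumberTheory.Weil1964
open Literature.RepresentationTheory.HeisenbergGroup Literature.RepresentationTheory.HarrisKudlaSweet1996
open Literature.NumberTheory.GaloisRepresentations
open Literature.NumberTheory.GelbartRogawski1991.UnitaryDualPair.LocalSplitting
open Literature.NumberTheory.K2Lit.LocalSiegelDoubled
open Literature.NumberTheory.GelbartRogawski1991.UnitaryDualPair (complexConj_imagUnit imagUnit_ne_zero imagUnit_mul_self)

namespace Summit.HodgeConjecture.HodgeConjecture.Cruxes.HLiu418.K2LiuSiegelWeilSectionMem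

/-! ## §0  Abstract bookkeeping: a splitting `s : G →* M̃`, a representation `ω` of `M̃`, an involution `w₀ ∈ G`

All group ∕ operator algebra is done here over ABSTRACT carriers (so that no rewriting ever happens inside the doubled CM
datum's telescope; the heavy declarations of §1 only instantiate these identities). -/

section Abstract

variable {G Mp V : Type*} [Group G] [Group Mp] [AddCommMonoid V] [Module ℂ V]

/-- group bookkeeping: `w (a b) w = (w a w)(w b w)` for an involution `w`. [cite: Kudla1994, §3 Thm. 3.1] -/
theorem conj_mul_conj {w : G} (hw : w * w = 1) (a b : G) : w * (a * b) * w = w * a * w * (w * b * w) := by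
  have h : w * a * w * (w * b * w) = w * a * (w * w) * b * w := by simp only [mul_assoc]
  rw [h, hw, mul_one]
  simp only [mul_assoc]

/-- **smoothness transport**: if `ω(s(w₀ u w₀))` fixes `Φ`, then `ω(M) ω(s(w₀ (h u) w₀)) Φ = ω(M) ω(s(w₀ h w₀)) Φ`.
[cite: MoeglinVignerasWaldspurger1987, Chap. 2 II.8] -/
theorem rep_conj_mul_of_fixed (s : G →* Mp) (ω : Representation ℂ Mp V) (M : Mp) {w₀ : G} (hw₀ : w₀ * w₀ = 1)
    (h u : G) (Φ : V) (hfix : ω (s (w₀ * u * w₀)) Φ = Φ) :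
    ω M (ω (s (w₀ * (h * u) * w₀)) Φ) = ω M (ω (s (w₀ * h * w₀)) Φ) := by
  rw [conj_mul_conj hw₀ h u, map_mul, map_mul, Module.End.mul_apply, hfix]

/-- **parabolic transport**: `ω(m₀ s(w₀)) ω(s(w₀ (p h) w₀)) Φ = ω(m₀ s(p) m₀⁻¹) (ω(m₀ s(w₀)) ω(s(w₀ h w₀)) Φ)` — in `M̃`,
`m₀ s(w₀) s(w₀ (p h) w₀) = m₀ s(p h w₀) = (m₀ s(p) m₀⁻¹)(m₀ s(w₀) s(w₀ h w₀))` (`w₀ w₀ = 1`, `s` a homomorphism).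
[cite: Kudla1994, §3 Thm. 3.1] -/
theorem rep_conj_parabolic (s : G →* Mp) (ω : Representation ℂ Mp V) (m₀ : Mp) {w₀ : G} (hw₀ : w₀ * w₀ = 1)
    (p h : G) (Φ : V) :
    ω (m₀ * s w₀) (ω (s (w₀ * (p * h) * w₀)) Φ) =
      ω (m₀ * s p * m₀⁻¹) (ω (m₀ * s w₀) (ω (s (w₀ * h * w₀)) Φ)) := by
  have key : ∀ x : G, m₀ * s w₀ * s (w₀ * x) = m₀ * s x := fun x => by
    rw [mul_assoc, ← map_mul, ← mul_assoc w₀ w₀ x, hw₀, one_mul]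
  have hgrp : m₀ * s w₀ * s (w₀ * (p * h) * w₀) = m₀ * s p * m₀⁻¹ * (m₀ * s w₀ * s (w₀ * h * w₀)) := by
    have e1 : w₀ * (p * h) * w₀ = w₀ * (p * (h * w₀)) := by simp only [mul_assoc]
    have e2 : w₀ * h * w₀ = w₀ * (h * w₀) := mul_assoc _ _ _
    rw [e1, e2, key, key, map_mul, mul_assoc (m₀ * _) m₀⁻¹, inv_mul_cancel_left, mul_assoc]
  rw [← Module.End.mul_apply, ← map_mul, hgrp, map_mul ω (m₀ * s p * m₀⁻¹), Module.End.mul_apply,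
    map_mul ω (m₀ * s w₀), Module.End.mul_apply]

end Abstract

/-! ## §1  The Siegel–Weil function: smoothness and the parabolic law -/

section SW

variable (L : Type) [Field L] [NumberField L] [IsCMField L] (v : HeightOneSpectrum (𝓞 (maximalRealSubfield L)))
  [MeasurableSpace (v.adicCompletion (maximalRealSubfield L))] [BorelSpace (v.adicCompletion (maximalRealSubfield L))]
  (μ : Measure (v.adicCompletion (maximalRealSubfield L))) [μ.IsAddHaarMeasure]
  (n : ℕ) {T₀ : Matrix (Fin n) (Fin n) (maximalRealSubfield L)} (hT₀ : T₀.IsSymm) (hT₀d : IsUnit T₀.det)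
  (χ : HeckeCharacter L) (hχ : IsSplittingChar L 1 χ)
  (m₀ : LocalMp (maximalRealSubfield L) (n + n) (gramD (maximalRealSubfield L) n T₀) v)
  (w₀ : UnitaryGroup.localPi L (IsCMField.complexConj L) (n + n)
    ((gramD (maximalRealSubfield L) n T₀).map (algebraMap (maximalRealSubfield L) L)) v)

set_option maxHeartbeats 4000000 in -- the doubled CM datum's telescope (as in ★ `LocalSplittingCMParabolicEigenfunctional`)
/-- **The open stabiliser of `Φ`**: the doubled CM datum is SMOOTH — there is an open subgroup `U₀` of `H(L⁺_v)` with
`ω(s(k)) Φ = Φ` for `k ∈ U₀` (★ `LocalSplittingDatum.smooth`, read through ★ `localOmega_apply`: `ω(s k) = β(k)⁻¹ • r(ι k)`).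
[cite: MoeglinVignerasWaldspurger1987, Chap. 2 II.8] [cite: Kudla1994, §3 Thm. 3.1] -/
theorem toRep_localSplitting_fixed (Φ : SchwartzBruhat (Fin (n + n) → v.adicCompletion (maximalRealSubfield L))) :
    ∃ U₀ : Subgroup (UnitaryGroup.localPi L (IsCMField.complexConj L) (n + n)
        ((gramD (maximalRealSubfield L) n T₀).map (algebraMap (maximalRealSubfield L) L)) v),
      IsOpen (U₀ : Set (UnitaryGroup.localPi L (IsCMField.complexConj L) (n + n)
        ((gramD (maximalRealSubfield L) n T₀).map (algebraMap (maximalRealSubfield L) L)) v)) ∧ ∀ k ∈ U₀,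
        MpPsi.toRep (localSchrodinger (maximalRealSubfield L) (n + n) (gramD (maximalRealSubfield L) n T₀) v)
          ((localSplittingDatumCM L v μ n hT₀ hT₀d rfl χ hχ).localSplitting k) Φ = Φ := by
  obtain ⟨U₀, hU₀, hfix⟩ := (localSplittingDatumCM L v μ n hT₀ hT₀d rfl χ hχ).smooth Φ
  refine ⟨U₀, hU₀, fun k hk => ?_⟩
  change (localSplittingDatumCM L v μ n hT₀ hT₀d rfl χ hχ).localOmega k Φ = Φ
  rw [LocalSplittingDatum.localOmega_apply]
  exact hfix k hk

set_option maxHeartbeats 4000000 in -- the doubled CM datum's telescope (as in ★ `LocalSplittingCMParabolicEigenfunctional`)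
/-- **SMOOTHNESS of `F_Φ(h) = (ω(m₀ s(w₀)) ω(s(w₀ h w₀)) Φ)(0)`**: with `U₀` the open stabiliser of `Φ` and
`U := {u ∣ w₀ u w₀⁻¹ ∈ U₀}` (open: preimage under the continuous conjugation; `w₀⁻¹ = w₀`), `F_Φ(h u) = F_Φ(h)` for `u ∈ U`,
since `ω(s(w₀ h u w₀)) Φ = ω(s(w₀ h w₀)) (ω(s(w₀ u w₀)) Φ)`.  This is ★ D1's `IsSmooth`.
[cite: HarrisKudlaSweet1996, §1 (1.15)] [cite: MoeglinVignerasWaldspurger1987, Chap. 2 II.8] -/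
theorem siegelWeilFn_isSmooth (hw₀ : w₀ * w₀ = 1)
    (Φ : SchwartzBruhat (Fin (n + n) → v.adicCompletion (maximalRealSubfield L))) :
    IsSmooth (maximalRealSubfield L) L (IsCMField.complexConj L) v n
      (fun h : UnitaryGroup.localPi L (IsCMField.complexConj L) (n + n)
          ((gramD (maximalRealSubfield L) n T₀).map (algebraMap (maximalRealSubfield L) L)) v =>
        ((MpPsi.toRep (localSchrodinger (maximalRealSubfield L) (n + n) (gramD (maximalRealSubfield L) n T₀) v)
              (m₀ * (localSplittingDatumCM L v μ n hT₀ hT₀d rfl χ hχ).localSplitting w₀)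
              (MpPsi.toRep (localSchrodinger (maximalRealSubfield L) (n + n) (gramD (maximalRealSubfield L) n T₀) v)
                ((localSplittingDatumCM L v μ n hT₀ hT₀d rfl χ hχ).localSplitting (w₀ * h * w₀)) Φ) :
            SchwartzBruhat (Fin (n + n) → v.adicCompletion (maximalRealSubfield L))) :
            (Fin (n + n) → v.adicCompletion (maximalRealSubfield L)) → ℂ) 0) := by
  obtain ⟨U₀, hU₀, hfix⟩ := toRep_localSplitting_fixed L v μ n hT₀ hT₀d χ hχ Φ
  have hinv : w₀⁻¹ = w₀ := inv_eq_of_mul_eq_one_right hw₀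
  have hc : Continuous ((MulAut.conj w₀).toMonoidHom :
      UnitaryGroup.localPi L (IsCMField.complexConj L) (n + n)
          ((gramD (maximalRealSubfield L) n T₀).map (algebraMap (maximalRealSubfield L) L)) v →*
        UnitaryGroup.localPi L (IsCMField.complexConj L) (n + n)
          ((gramD (maximalRealSubfield L) n T₀).map (algebraMap (maximalRealSubfield L) L)) v) :=
    IsTopologicalGroup.continuous_conj w₀
  refine ⟨(⟨U₀, hU₀⟩ : OpenSubgroup _).comap (MulAut.conj w₀).toMonoidHom hc, fun h u hu => ?_⟩
  have hu' : w₀ * u * w₀ ∈ U₀ := by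
    have hu₁ : (MulAut.conj w₀).toMonoidHom u ∈ U₀ := hu
    rw [MulEquiv.coe_toMonoidHom, MulAut.conj_apply, hinv] at hu₁
    exact hu₁
  -- all operator algebra abstractly (§0), transported by `congrArg` (no rewriting inside the telescope)
  exact congrArg (fun Ψ : SchwartzBruhat (Fin (n + n) → v.adicCompletion (maximalRealSubfield L)) =>
    ((Ψ : SchwartzBruhat (Fin (n + n) → v.adicCompletion (maximalRealSubfield L))) :
      (Fin (n + n) → v.adicCompletion (maximalRealSubfield L)) → ℂ) 0)
    (rep_conj_mul_of_fixed (localSplittingDatumCM L v μ n hT₀ hT₀d rfl χ hχ).localSplitting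
      (MpPsi.toRep (localSchrodinger (maximalRealSubfield L) (n + n) (gramD (maximalRealSubfield L) n T₀) v))
      (m₀ * (localSplittingDatumCM L v μ n hT₀ hT₀d rfl χ hχ).localSplitting w₀) hw₀ h u Φ (hfix (w₀ * u * w₀) hu'))

set_option maxHeartbeats 4000000 in -- the doubled CM datum's telescope (as in ★ `LocalSplittingCMParabolicEigenfunctional`)
/-- **THE PARABOLIC LAW of `F_Φ`** with the Kudla–Weil eigen-scalar: for `p ∈ P_Δ(L⁺_v)` (★ `IsSiegelDelta`) and every `h`,
`F_Φ(p h) = (χ_v⁻¹(det_Δ p))⁻¹ · ∏_{w ∣ v} ‖det_Δ p_w‖^{1∕2} · F_Φ(h)`.  In `S̃p_ψ(𝕎^𝔻_v)`: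
`m₀ s(w₀) s(w₀ (p h) w₀) = m₀ s(p h w₀) = (m₀ s(p) m₀⁻¹) · (m₀ s(w₀) s(w₀ h w₀))` (`w₀ w₀ = 1`, `s` a homomorphism), so
`ω(m₀ s(w₀)) ω(s(w₀ p h w₀)) Φ = ω(m₀ s(p) m₀⁻¹) Θ` with `Θ = ω(m₀ s(w₀)) ω(s(w₀ h w₀)) Φ`, and the CM datum's PARABOLIC
NORMALISATION in operator form ★ `parabolic_toRep_conj_localSplittingDatumCM` (`(ω(m₀ s(p) m₀⁻¹) Θ)(0) = e(p) Θ(0)`, `m₀` carrying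
`ℓ_Δ` onto `ℓ_Y`) finishes.  (Equivalently: the `w₀`-twisted EIGEN-LAW ★ `apply_zero_toRep_mul_localSplitting_eq_mul` at `p′ = w₀ p w₀`.)
[cite: Kudla1994, §3 Thm. 3.1] [cite: HarrisKudlaSweet1996, §1 (1.16)] -/
theorem siegelWeilFn_parabolic_mul
    (hm₀ : (deltaLagrangian (maximalRealSubfield L) v n).map (toLin (maximalRealSubfield L) v (MpPsi.proj _ m₀)) =
      lagrangianY (maximalRealSubfield L) (n + n) v)
    (hw₀ : w₀ * w₀ = 1) (Φ : SchwartzBruhat (Fin (n + n) → v.adicCompletion (maximalRealSubfield L)))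
    (p h : UnitaryGroup.localPi L (IsCMField.complexConj L) (n + n)
      ((gramD (maximalRealSubfield L) n T₀).map (algebraMap (maximalRealSubfield L) L)) v)
    (hp : IsSiegelDelta (maximalRealSubfield L) L (IsCMField.complexConj L) (complexConj_imagUnit L) (imagUnit_ne_zero L)
      (imagUnit_mul_self L) v n hT₀ rfl p) :
    ((MpPsi.toRep (localSchrodinger (maximalRealSubfield L) (n + n) (gramD (maximalRealSubfield L) n T₀) v)
          (m₀ * (localSplittingDatumCM L v μ n hT₀ hT₀d rfl χ hχ).localSplitting w₀)
          (MpPsi.toRep (localSchrodinger (maximalRealSubfield L) (n + n) (gramD (maximalRealSubfield L) n T₀) v)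
            ((localSplittingDatumCM L v μ n hT₀ hT₀d rfl χ hχ).localSplitting (w₀ * (p * h) * w₀)) Φ) :
        SchwartzBruhat (Fin (n + n) → v.adicCompletion (maximalRealSubfield L))) :
        (Fin (n + n) → v.adicCompletion (maximalRealSubfield L)) → ℂ) 0 =
      (((chiDet (maximalRealSubfield L) L (IsCMField.complexConj L) v n
            (fun w' : PlacesOver L v => (χ.localComponent w'.1)⁻¹) p)⁻¹ : ℂˣ) : ℂ) *
        ((∏ w' : PlacesOver L v,
            Real.sqrt ‖detDelta (maximalRealSubfield L) L (IsCMField.complexConj L) v n w' p‖ : ℝ) : ℂ) *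
        ((MpPsi.toRep (localSchrodinger (maximalRealSubfield L) (n + n) (gramD (maximalRealSubfield L) n T₀) v)
              (m₀ * (localSplittingDatumCM L v μ n hT₀ hT₀d rfl χ hχ).localSplitting w₀)
              (MpPsi.toRep (localSchrodinger (maximalRealSubfield L) (n + n) (gramD (maximalRealSubfield L) n T₀) v)
                ((localSplittingDatumCM L v μ n hT₀ hT₀d rfl χ hχ).localSplitting (w₀ * h * w₀)) Φ) :
            SchwartzBruhat (Fin (n + n) → v.adicCompletion (maximalRealSubfield L))) :
            (Fin (n + n) → v.adicCompletion (maximalRealSubfield L)) → ℂ) 0 := by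
  -- the operator identity, abstractly (§0 `rep_conj_parabolic`), instantiated at `s := s^𝔻`, `ω := toRep`
  have hL := rep_conj_parabolic (localSplittingDatumCM L v μ n hT₀ hT₀d rfl χ hχ).localSplitting
    (MpPsi.toRep (localSchrodinger (maximalRealSubfield L) (n + n) (gramD (maximalRealSubfield L) n T₀) v)) m₀ hw₀ p h Φ
  -- the CM datum's parabolic normalisation at `p ∈ P_Δ`
  have hpar := parabolic_toRep_conj_localSplittingDatumCM L v μ n hT₀ hT₀d rfl χ hχ m₀ hm₀ p hp
    (MpPsi.toRep (localSchrodinger (maximalRealSubfield L) (n + n) (gramD (maximalRealSubfield L) n T₀) v)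
      (m₀ * (localSplittingDatumCM L v μ n hT₀ hT₀d rfl χ hχ).localSplitting w₀)
      (MpPsi.toRep (localSchrodinger (maximalRealSubfield L) (n + n) (gramD (maximalRealSubfield L) n T₀) v)
        ((localSplittingDatumCM L v μ n hT₀ hT₀d rfl χ hχ).localSplitting (w₀ * h * w₀)) Φ))
  exact (congrArg (fun Ψ : SchwartzBruhat (Fin (n + n) → v.adicCompletion (maximalRealSubfield L)) =>
    ((Ψ : SchwartzBruhat (Fin (n + n) → v.adicCompletion (maximalRealSubfield L))) :
      (Fin (n + n) → v.adicCompletion (maximalRealSubfield L)) → ℂ) 0) hL).trans hpar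

end SW

/-! ## §2  The head -/

set_option maxHeartbeats 4000000 in -- the doubled CM datum's telescope (as in ★ `LocalSplittingCMParabolicEigenfunctional`)
/-- **PAYMENT OF `sig_K2LiuSiegelWeilSectionMem`** (socket #7b of unit U3c «LOCAL SIEGEL» of the K2_Liu road,
`Cruxes/HLiu418/Lines/K2_Liu_CurveThetaSigs_U3c_LocalSiegel.lean` ED. 2, TOKEN FOR TOKEN).  For the doubled CM Weil datum at a
finite place `v` (★ telescope `localSplittingDatumCM L v μ n hT₀ hT₀d rfl χ hχ`), an implementer `m₀` carrying `ℓ_Δ` onto `ℓ_Y`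
and an involution `w₀`, the Siegel–Weil function `F_Φ(h) = (ω(m₀ s(w₀)) ω(s(w₀ h w₀)) Φ)(0)` lies in
`I_v((1 − n)∕2, χ_v) = localDegPS … (fun w′ ↦ χ.localComponent w′) ((1 − n)∕2)`: SECTION LAW = §1 `siegelWeilFn_parabolic_mul`
(★ eigen-law `apply_zero_toRep_mul_localSplitting_eq_mul` at `p′ = w₀ p w₀`) + ★ #7a `siegelWeilScalarEqCharacter`
(eigen-scalar = `localSiegelCharacter χ_v ((1 − n)∕2)`); SMOOTHNESS = §1 `siegelWeilFn_isSmooth` (open stabiliser of `Φ`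
conjugated by `w₀`).  [HarrisKudlaSweet1996 §1 (1.15)–(1.16): `Φ ↦ ω(·)Φ(0) ∈ I_n(s₀, χ)`; Liu 2021 §B.3 `J_a(s, μᶜ)_v`.]
[cite: HarrisKudlaSweet1996, §1 (1.16)] [cite: Liu2021, §B.3 p. 101] [cite: Kudla1994, §3 Thm. 3.1] -/
theorem siegelWeilSectionMem :
    ∀ (L : Type) [Field L] [NumberField L] [IsCMField L] (v : HeightOneSpectrum (𝓞 (maximalRealSubfield L)))
      [MeasurableSpace (v.adicCompletion (maximalRealSubfield L))] [BorelSpace (v.adicCompletion (maximalRealSubfield L))]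
      (μ : Measure (v.adicCompletion (maximalRealSubfield L))) [μ.IsAddHaarMeasure]
      (n : ℕ) {T₀ : Matrix (Fin n) (Fin n) (maximalRealSubfield L)} (hT₀ : T₀.IsSymm) (hT₀d : IsUnit T₀.det)
      (χ : HeckeCharacter L) (hχ : IsSplittingChar L 1 χ)
      (m₀ : LocalMp (maximalRealSubfield L) (n + n) (gramD (maximalRealSubfield L) n T₀) v)
      (_hm₀ : (deltaLagrangian (maximalRealSubfield L) v n).map (toLin (maximalRealSubfield L) v (MpPsi.proj _ m₀)) =
        lagrangianY (maximalRealSubfield L) (n + n) v)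
      (w₀ : UnitaryGroup.localPi L (IsCMField.complexConj L) (n + n)
        ((gramD (maximalRealSubfield L) n T₀).map (algebraMap (maximalRealSubfield L) L)) v)
      (_hw₀ : w₀ * w₀ = 1)
      (Φ : SchwartzBruhat (Fin (n + n) → v.adicCompletion (maximalRealSubfield L))),
      (fun h : UnitaryGroup.localPi L (IsCMField.complexConj L) (n + n)
          ((gramD (maximalRealSubfield L) n T₀).map (algebraMap (maximalRealSubfield L) L)) v =>
        ((MpPsi.toRep (localSchrodinger (maximalRealSubfield L) (n + n) (gramD (maximalRealSubfield L) n T₀) v)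
              (m₀ * (localSplittingDatumCM L v μ n hT₀ hT₀d rfl χ hχ).localSplitting w₀)
              (MpPsi.toRep (localSchrodinger (maximalRealSubfield L) (n + n) (gramD (maximalRealSubfield L) n T₀) v)
                ((localSplittingDatumCM L v μ n hT₀ hT₀d rfl χ hχ).localSplitting (w₀ * h * w₀)) Φ) :
            SchwartzBruhat (Fin (n + n) → v.adicCompletion (maximalRealSubfield L))) :
            (Fin (n + n) → v.adicCompletion (maximalRealSubfield L)) → ℂ) 0)
        ∈ localDegPS (maximalRealSubfield L) L (IsCMField.complexConj L) (complexConj_imagUnit L) (imagUnit_ne_zero L)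
            (imagUnit_mul_self L) v n hT₀ rfl (fun w' : PlacesOver L v => χ.localComponent w'.1) ((1 - (n : ℂ)) / 2) := by
  intro L _ _ _ v _ _ μ _ n T₀ hT₀ hT₀d χ hχ m₀ hm₀ w₀ hw₀ Φ
  refine (mem_localDegPS_iff (maximalRealSubfield L) L (IsCMField.complexConj L) (complexConj_imagUnit L) (imagUnit_ne_zero L)
    (imagUnit_mul_self L) v n hT₀ rfl _ _ _).2 ⟨fun p hp h => ?_, siegelWeilFn_isSmooth L v μ n hT₀ hT₀d χ hχ m₀ w₀ hw₀ Φ⟩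
  rw [← K2LiuSiegelWeilScalarEqCharacter.siegelWeilScalarEqCharacter L v n χ p]
  exact siegelWeilFn_parabolic_mul L v μ n hT₀ hT₀d χ hχ m₀ w₀ hm₀ hw₀ Φ p h hp

end Summit.HodgeConjecture.HodgeConjecture.Cruxes.HLiu418.K2LiuSiegelWeilSectionMem

end
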